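import Summits.NavierStokesRegularity.FluidComputer.TubeRestartRun
import HarnessLib

/-!
# Clock-section restart of the certified tube: from "restart at a slice" (an instant) to "sweep
# across the clock window of a slice inside its fibre" (an open, checkable condition)

HONEST FRAMING (cell `pub-fluidc`, blueprint seat bp3, gen 16): low prior, high value-of-information
experiment on Tao's machine paradigm; NOT a claim that NS blows up. Everything here concerns the
5-mode quadratic, energy-conserving TRUNCATION `thresholdCircuit` (a superposition of the gates of
[Tao2016AveragedNS, §5]) with an ABSTRACT forcing of sup-size `δ`; nothing is proved about the
Navier–Stokes equations, and nothing here certifies the ramp, stage 4 or the cascade.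

WHY. The kernel tube of gen 13 (`TubeTable`) records 49 cross-sections `sT k` and gen 15 restarts the
whole stage certificate from each of them (`TubeRestart.sliceStage`, input `SliceE k`). But a slice is
an INSTANT of the design pulse: its clock window has half-width `≈ 10⁻⁵` while the clock `b` advances
by `≈ 4.9·10⁻³` per chunk, so consecutive slices are DISJOINT in the clock coordinate (§1,
`sT_clock_disjoint`, by `decide` on the recorded integers) and the union of the 48 restart classes
contains no continuum of post-ramp states of a downstream gate. The continuum is recovered by
TIME-SHIFT, which costs nothing for an autonomous design field with an autonomous defect budget: a
post-ramp trajectory sweeps its clock monotonically (`b' = εa² − νc² ± δ > 0` before the threshold, §3)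
and therefore CROSSES the clock window of every later slice; at the crossing instant the only question
is whether the OTHER coordinates — carrier, trigger, rotor: the FIBRE of the slice (§1) — and the energy
sit inside. §2 is the intermediate value theorem on the clock coordinate; §4 composes it with ANY
stage-from-a-set statement of the shape proved in gen 15 (`slice_reach_outputAbove`): a forced window
that sweeps the clock window of box `B` inside `fibre B ∩ F` restarts, at some instant of the sweep, a
stage served from any `S ⊇ boxSection B ∩ F`, and reaches that stage's target within the stage's cycle
time counted from the crossing instant (`section_restart`). §5 instantiates the data side for the
recorded slices (`sT_clock_le`: every recorded clock window is a genuine interval), so that with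
`S = SliceE k`, `F = energyBand k`, `T = TfromT k + T₃L`, `A = outputAbove zL` and gen 15's
`slice_reach_outputAbove` as `hstage` the conclusion is the loaded, correctly signed output
(`TubeSectionSlice.lean`, the companion file, once `TubeRestart.lean` is in the tree).

MEASURED CONTEXT (not a theorem; `code/thgate/g16/section_audit.py`,
`data/thgate/chain-g16/SECTION-AUDIT.md`): in the coupled two-gate chain at the design point
(A = 2, od = 20) the downstream gate, after its input ramp, crosses the clock section of EVERY later
slice with carrier/clock/trigger offsets `≤ 0.005` half-widths and energy in the band, and its rotor
miss DECAYS along the tube: inside the thin kernel ellipse from slice `k = 4 / 7 / 22 / 29 / 34` on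
(`t = 0.10 / 0.17 / 0.54 / 0.71 / 0.83` of the `1.08` tube) for frequency ratio `Λ = 1 / 2 / 4 / 5.657 / 8`,
persisting to the crossing; the same holds for 28 of 29 synthetic influx shapes × durations `≤ 1.5`.
So the hypotheses of `section_restart` are the shape a future RAMP certificate must deliver — at a
LATE slice, with the THIN in-tree kernel data; the fat slice of gen 15 only buys margin.

* §6 `ellipse_mono`, `boxSubCrit`, `mem_of_boxSubCrit` — containment of one tube box in another by a
  denominator-free integer test (used by `TubeRestartPost18` to JOIN the post-ramp tube with the design tube).

[cite: Tao2016AveragedNS, §5.5 Thm 5.3 (5.5)]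
-/

noncomputable section

open Set Filter Topology
open scoped Pointwise

namespace Summit.NavierStokesRegularity.FluidComputer

open Literature.Analysis.FluidPDE.Tao2016AveragedNS
open Literature.Analysis.FluidPDE.FluidComputer
open Literature.Analysis.FluidPDE.FluidComputer.TubeTable
open Literature.Analysis.ODE (mul_le_sub_of_le_deriv_right)

namespace TubeStage

/-! ### §1. The fibre and the section of a tube box; the recorded slices are disjoint in the clock -/

/-- The **fibre** of a tube box: every coordinate condition of `TubeBox.mem` except the clock window
(carrier interval, trigger interval, rotor ellipse). [folklore] -/
def fibre (B : TubeBox) : Set (Fin 5 → ℝ) :=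
  {X | (B.al ≤ X 0 ∧ X 0 ≤ B.ah) ∧ (B.cl ≤ X 2 ∧ X 2 ≤ B.ch) ∧
    2 * (X 3 - B.dc) ^ 2 + (X 4 - B.zc) ^ 2 ≤ B.V}

/-- The **section** of a tube box: the set of states in it. [folklore] -/
def boxSection (B : TubeBox) : Set (Fin 5 → ℝ) := {X | B.mem X}

/-- A state is in the box iff it is in the fibre and its clock is in the clock window. [folklore] -/
theorem mem_boxSection_iff (B : TubeBox) (X : Fin 5 → ℝ) :
    X ∈ boxSection B ↔ X ∈ fibre B ∧ X 1 ∈ Icc B.bl B.bh := by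
  simp only [boxSection, fibre, TubeBox.mem, mem_setOf_eq, mem_Icc]
  tauto

/-- **Consecutive recorded slices are disjoint in the clock**: the clock window of slice `k + 1` lies
strictly above that of slice `k`, for every `k < 48` (recorded integers at scale `2^60`; the gap is
`≈ 4.9·10⁻³ ≫ 2·10⁻⁵ =` window width). This is why restart-at-a-slice covers no continuum and the
clock SECTION is the right restart object. [folklore] -/
theorem sT_clock_disjoint : ∀ k < NT, (sT k).B.bh < (sT (k + 1)).B.bl := by
  decide

/-- Every recorded clock window is a genuine interval (`bl ≤ bh`), `k ≤ 48`. [folklore] -/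
theorem sT_clock_le : ∀ k ≤ NT, (sT k).B.bl ≤ (sT k).B.bh := by
  decide

/-- Real form of `sT_clock_le`. [folklore] -/
theorem sT_clock_le_real {k : ℕ} (hk : k ≤ NT) :
    ((sT k).B.toR 60).bl ≤ ((sT k).B.toR 60).bh := by
  have h := sT_clock_le k hk
  simp only [TubeBoxD.toR]
  exact div_le_div_of_nonneg_right (by exact_mod_cast h) (by positivity)

/-! ### §2. Crossing the clock window: the intermediate value theorem on the clock coordinate -/

/-- **IVT on the clock.** A curve continuous on `[t₁, t₂]` whose clock is at most `bh` at `t₁` and at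
least `bl` at `t₂` takes a clock value in `[bl, bh]` at some instant of `[t₁, t₂]`. [folklore] -/
theorem exists_clock_mem_Icc {x : ℝ → Fin 5 → ℝ} {t₁ t₂ bl bh : ℝ} (h12 : t₁ ≤ t₂)
    (hc : ContinuousOn x (Icc t₁ t₂)) (hlo : x t₁ 1 ≤ bh) (hhi : bl ≤ x t₂ 1) (hb : bl ≤ bh) :
    ∃ t ∈ Icc t₁ t₂, x t 1 ∈ Icc bl bh := by
  by_cases h1 : bl ≤ x t₁ 1
  · exact ⟨t₁, left_mem_Icc.2 h12, h1, hlo⟩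
  · rw [not_le] at h1
    have hcn : ContinuousOn (fun t => x t 1) (Icc t₁ t₂) :=
      (continuous_apply 1).comp_continuousOn hc
    obtain ⟨t, ht, hft⟩ := intermediate_value_Icc h12 hcn ⟨h1.le, hhi⟩
    refine ⟨t, ht, ?_⟩
    simp only at hft
    rw [hft]
    exact ⟨le_rfl, hb⟩

/-- **SECTION CROSSING.** If moreover the curve stays in the fibre of box `B` on `[t₁, t₂]`, it is IN
the box at some instant of `[t₁, t₂]`. [folklore] -/
theorem exists_mem_boxSection_of_sweep {x : ℝ → Fin 5 → ℝ} {t₁ t₂ : ℝ} (B : TubeBox) (h12 : t₁ ≤ t₂)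
    (hc : ContinuousOn x (Icc t₁ t₂)) (hlo : x t₁ 1 ≤ B.bh) (hhi : B.bl ≤ x t₂ 1) (hb : B.bl ≤ B.bh)
    (hF : ∀ t ∈ Icc t₁ t₂, x t ∈ fibre B) :
    ∃ t ∈ Icc t₁ t₂, x t ∈ boxSection B := by
  obtain ⟨t, ht, hbt⟩ := exists_clock_mem_Icc h12 hc hlo hhi hb
  exact ⟨t, ht, (mem_boxSection_iff B (x t)).2 ⟨hF t ht, hbt⟩⟩

/-! ### §3. The clock is a clock: a linear lower bound before the threshold -/

/-- **Clock advance on a forced window.** If `εa² − νc² ≥ m + δ` on `[0, τ)` then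
`b(t) ≥ b(0) + m·t` on `[0, τ]`: with `m > 0` the clock is strictly increasing and sweeps a window of
width `w` within time `w/m`. (Before the threshold `a ≈ 1`, `c ≈ 4·10⁻⁶`, so `m ≈ ε = 0.2` at the
design point.) [folklore] -/
theorem clock_ge_linear {ε σ ν μ r κ δ τ : ℝ} {x : ℝ → Fin 5 → ℝ}
    (h : IsForcedWindow ε σ ν μ r κ δ τ x) {m : ℝ}
    (hm : ∀ t ∈ Ico 0 τ, m + δ ≤ ε * x t 0 ^ 2 - ν * x t 2 ^ 2) :
    ∀ t ∈ Icc 0 τ, x 0 1 + m * t ≤ x t 1 := by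
  choose! V hV hVδ using h.defect
  have hcn : ContinuousOn (fun s => x s 1) (Icc 0 τ) :=
    (continuous_apply 1).comp_continuousOn h.continuousOn
  have hdv : ∀ s ∈ Ico 0 τ, HasDerivWithinAt (fun s => x s 1) (V s 1) (Ici s) s :=
    fun s hs => (hasDerivWithinAt_pi.1 (hV s hs)) 1
  have hbd : ∀ s ∈ Ico 0 τ, m ≤ V s 1 := by
    intro s hs
    have hg := abs_apply_le_of_norm_le (hVδ s hs) 1
    rw [Pi.sub_apply, thresholdCircuit_apply_one] at hg
    have h1 := (abs_le.1 hg).1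
    have h2 := hm s hs
    nlinarith
  intro t ht
  have key := mul_le_sub_of_le_deriv_right hcn hdv hbd t ht
  simp only [sub_zero] at key
  linarith

/-- **The sweep ends above the window.** Under the hypothesis of `clock_ge_linear` with `m > 0`, at any
time `t ≥ (bh − b(0))/m` of the window the clock is at least `bh`. [folklore] -/
theorem clock_ge_of_linear {ε σ ν μ r κ δ τ : ℝ} {x : ℝ → Fin 5 → ℝ}
    (h : IsForcedWindow ε σ ν μ r κ δ τ x) {m bh : ℝ} (hm0 : 0 < m)
    (hm : ∀ t ∈ Ico 0 τ, m + δ ≤ ε * x t 0 ^ 2 - ν * x t 2 ^ 2)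
    {t : ℝ} (ht : t ∈ Icc 0 τ) (hbt : (bh - x 0 1) / m ≤ t) : bh ≤ x t 1 := by
  have h1 := clock_ge_linear h hm t ht
  have h2 : bh - x 0 1 ≤ m * t := by
    have := (div_le_iff₀ hm0).1 hbt
    linarith
  linarith

/-! ### §4. The restart theorem -/

/-- **CLOCK-SECTION RESTART.** Let `x` be a `δ`-forced window of length `τ` of the threshold circuit,
`0 ≤ t₁ ≤ t₂` with `t₂ + T ≤ τ`. Suppose that on `[t₁, t₂]` the curve lies in the fibre of box `B` and
in a set `F` (in applications: an energy band), that its clock is at most `B.bh` at `t₁` and at least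
`B.bl` at `t₂`, and that a STAGE is served from a set `S ⊇ boxSection B ∩ F`: every `δ`-forced window of
length `T` starting in `S` visits `A` within time `T`. Then at some instant `t ∈ [t₁, t₂]` the curve is
in `S`, and it visits `A` within time `T` after that instant. (Autonomy of the design field and of the
defect budget is what makes the restart free: `IsForcedWindow.shift`.) [folklore] -/
theorem section_restart {ε σ ν μ r κ δ τ T t₁ t₂ : ℝ} {x : ℝ → Fin 5 → ℝ} (B : TubeBox)
    {F S A : Set (Fin 5 → ℝ)} (hW : IsForcedWindow ε σ ν μ r κ δ τ x) (h0 : 0 ≤ t₁)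
    (h12 : t₁ ≤ t₂) (hT : 0 ≤ T) (hτ : t₂ + T ≤ τ) (hlo : x t₁ 1 ≤ B.bh) (hhi : B.bl ≤ x t₂ 1)
    (hb : B.bl ≤ B.bh) (hF : ∀ t ∈ Icc t₁ t₂, x t ∈ fibre B ∩ F) (hS : boxSection B ∩ F ⊆ S)
    (hstage : ∀ y : ℝ → Fin 5 → ℝ, IsForcedWindow ε σ ν μ r κ δ T y → y 0 ∈ S →
      ∃ s ∈ Icc 0 T, y s ∈ A) :
    ∃ t ∈ Icc t₁ t₂, x t ∈ S ∧ ∃ s ∈ Icc t (t + T), x s ∈ A := by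
  have hsub : Icc t₁ t₂ ⊆ Icc 0 τ := Icc_subset_Icc h0 (by linarith)
  have hc : ContinuousOn x (Icc t₁ t₂) := hW.continuousOn.mono hsub
  obtain ⟨t, ht, hmem⟩ :=
    exists_mem_boxSection_of_sweep B h12 hc hlo hhi hb fun s hs => (hF s hs).1
  have hxS : x t ∈ S := hS ⟨hmem, (hF t ht).2⟩
  have hshift : IsForcedWindow ε σ ν μ r κ δ T (fun s => x (t + s)) :=
    (hW.shift ⟨h0.trans ht.1, by linarith [ht.2]⟩).mono (by linarith [ht.2])
  obtain ⟨s, hs, hA⟩ := hstage _ hshift (by simpa using hxS)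
  exact ⟨t, ht, hxS, t + s, ⟨by linarith [hs.1], by linarith [hs.2]⟩, hA⟩

/-- **CLOCK-SECTION RESTART, with the sweep certified by the clock bound of §3.** Same, with the
hypothesis "clock at least `B.bl` at `t₂`" replaced by the checkable rate condition
`εa² − νc² ≥ m + δ` on `[0, τ)` (`m > 0`) and the duration condition `t₂ ≥ (B.bl − b(0))/m`.
[folklore] -/
theorem section_restart_of_rate {ε σ ν μ r κ δ τ T t₁ t₂ : ℝ} {x : ℝ → Fin 5 → ℝ} (B : TubeBox)
    {F S A : Set (Fin 5 → ℝ)} (hW : IsForcedWindow ε σ ν μ r κ δ τ x) (h0 : 0 ≤ t₁)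
    (h12 : t₁ ≤ t₂) (hT : 0 ≤ T) (hτ : t₂ + T ≤ τ) (hlo : x t₁ 1 ≤ B.bh) {m : ℝ} (hm0 : 0 < m)
    (hm : ∀ t ∈ Ico 0 τ, m + δ ≤ ε * x t 0 ^ 2 - ν * x t 2 ^ 2) (ht₂ : (B.bl - x 0 1) / m ≤ t₂)
    (hb : B.bl ≤ B.bh) (hF : ∀ t ∈ Icc t₁ t₂, x t ∈ fibre B ∩ F) (hS : boxSection B ∩ F ⊆ S)
    (hstage : ∀ y : ℝ → Fin 5 → ℝ, IsForcedWindow ε σ ν μ r κ δ T y → y 0 ∈ S →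
      ∃ s ∈ Icc 0 T, y s ∈ A) :
    ∃ t ∈ Icc t₁ t₂, x t ∈ S ∧ ∃ s ∈ Icc t (t + T), x s ∈ A :=
  section_restart B hW h0 h12 hT hτ hlo
    (clock_ge_of_linear hW hm0 hm ⟨h0.trans h12, by linarith⟩ ht₂) hb hF hS hstage

/-! ### §5. The recorded slices as sections -/

/-- The gen-15 restart class of slice `k` is the section of the recorded box:
`{X | ((sT k).B.toR 60).mem X} = boxSection ((sT k).B.toR 60)` (definitionally; recorded here so that
`TubeRestart.Slice k` rewrites to it by `rfl`). [folklore] -/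
theorem boxSection_sT (k : ℕ) : boxSection ((sT k).B.toR 60) = {X | ((sT k).B.toR 60).mem X} := rfl

/-- **RESTART AT A RECORDED SLICE FROM A CLOCK SWEEP** — the data-facing form of `section_restart` for
slice `k ≤ 48`: the window condition `bl ≤ bh` is discharged by the recorded integers
(`sT_clock_le_real`); the stage hypothesis is left abstract (`hstage`), to be instantiated by gen 15's
`slice_reach_outputAbove hk : ∀ y, IsForcedWindow … (TfromT k + T₃L) y → y 0 ∈ SliceE k → ∃ s, …`
with `F = energyBand k`, `S = SliceE k = boxSection ((sT k).B.toR 60) ∩ energyBand k`. [folklore] -/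
theorem slice_section_restart {k : ℕ} (hk : k ≤ NT) {ε σ ν μ r κ δ τ T t₁ t₂ : ℝ}
    {x : ℝ → Fin 5 → ℝ} {F A : Set (Fin 5 → ℝ)} (hW : IsForcedWindow ε σ ν μ r κ δ τ x)
    (h0 : 0 ≤ t₁) (h12 : t₁ ≤ t₂) (hT : 0 ≤ T) (hτ : t₂ + T ≤ τ)
    (hlo : x t₁ 1 ≤ ((sT k).B.toR 60).bh) (hhi : ((sT k).B.toR 60).bl ≤ x t₂ 1)
    (hF : ∀ t ∈ Icc t₁ t₂, x t ∈ fibre ((sT k).B.toR 60) ∩ F)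
    (hstage : ∀ y : ℝ → Fin 5 → ℝ, IsForcedWindow ε σ ν μ r κ δ T y →
      y 0 ∈ boxSection ((sT k).B.toR 60) ∩ F → ∃ s ∈ Icc 0 T, y s ∈ A) :
    ∃ t ∈ Icc t₁ t₂, x t ∈ boxSection ((sT k).B.toR 60) ∩ F ∧ ∃ s ∈ Icc t (t + T), x s ∈ A :=
  section_restart ((sT k).B.toR 60) hW h0 h12 hT hτ hlo hhi (sT_clock_le_real hk) hF
    Subset.rfl hstage

/-! ### §6. Containment of tube boxes (used to JOIN a restarted tube with the design tube) -/

/-- **Ellipse containment by a denominator-free criterion**: if `2(x-d₁)² + (z-z₁)² ≤ V₁` and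
`(1+λ)λ·V₁ + (1+λ)·(2(d₁-d₂)² + (z₁-z₂)²) ≤ λ·V₂` with `λ > 0`, then `2(x-d₂)² + (z-z₂)² ≤ V₂`
(Minkowski + AM–GM for the norm `√(2u² + v²)`). [folklore] -/
theorem ellipse_mono {x z d₁ z₁ V₁ d₂ z₂ V₂ lam : ℝ} (hlam : 0 < lam)
    (h₁ : 2 * (x - d₁) ^ 2 + (z - z₁) ^ 2 ≤ V₁)
    (hcrit : (1 + lam) * lam * V₁ + (1 + lam) * (2 * (d₁ - d₂) ^ 2 + (z₁ - z₂) ^ 2) ≤ lam * V₂) :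
    2 * (x - d₂) ^ 2 + (z - z₂) ^ 2 ≤ V₂ := by
  have key : lam * (2 * (x - d₂) ^ 2 + (z - z₂) ^ 2) ≤
      (1 + lam) * lam * (2 * (x - d₁) ^ 2 + (z - z₁) ^ 2) +
        (1 + lam) * (2 * (d₁ - d₂) ^ 2 + (z₁ - z₂) ^ 2) := by
    nlinarith [sq_nonneg (lam * (x - d₁) - (d₁ - d₂)), sq_nonneg (lam * (z - z₁) - (z₁ - z₂)), hlam.le]
  have h2 : (1 + lam) * lam * (2 * (x - d₁) ^ 2 + (z - z₁) ^ 2) ≤ (1 + lam) * lam * V₁ :=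
    mul_le_mul_of_nonneg_left h₁ (by positivity)
  nlinarith

/-- The integer containment test of one tube box in another (intervals, and the ellipse criterion
with `λ = p/q` cleared of denominators; everything at scale `2^60`). [folklore] -/
def boxSubCrit (B C : TubeBoxD) (p q : ℕ) : Bool :=
  decide (C.al ≤ B.al) && decide (B.ah ≤ C.ah) && decide (C.bl ≤ B.bl) && decide (B.bh ≤ C.bh) &&
  decide (C.cl ≤ B.cl) && decide (B.ch ≤ C.ch) && decide (0 < p) && decide (0 < q) &&
  decide (((q : ℤ) + p) * p * (B.V * 2 ^ 60) + ((q : ℤ) + p) * q * (2 * (B.dc - C.dc) ^ 2 + (B.zc - C.zc) ^ 2)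
    ≤ (p : ℤ) * q * (C.V * 2 ^ 60))

/-- **Soundness of the containment test** (real forms at scale `2^60`). [folklore] -/
theorem mem_of_boxSubCrit {B C : TubeBoxD} {p q : ℕ} (h : boxSubCrit B C p q = true) {X : Fin 5 → ℝ}
    (hX : (B.toR 60).mem X) : (C.toR 60).mem X := by
  simp only [boxSubCrit, Bool.and_eq_true, decide_eq_true_eq] at h
  obtain ⟨⟨⟨⟨⟨⟨⟨⟨h1, h2⟩, h3⟩, h4⟩, h5⟩, h6⟩, hp⟩, hq⟩, hV⟩ := h
  obtain ⟨⟨ga1, ga2⟩, ⟨gb1, gb2⟩, ⟨gc1, gc2⟩, gV⟩ := hX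
  simp only [TubeBoxD.toR] at ga1 ga2 gb1 gb2 gc1 gc2 gV ⊢
  have c : ∀ {a b : ℤ}, a ≤ b → (a : ℝ) / 2 ^ 60 ≤ (b : ℝ) / 2 ^ 60 := fun h =>
    div_le_div_of_nonneg_right (Int.cast_le.2 h) (by positivity)
  refine ⟨⟨(c h1).trans ga1, ga2.trans (c h2)⟩, ⟨(c h3).trans gb1, gb2.trans (c h4)⟩,
    ⟨(c h5).trans gc1, gc2.trans (c h6)⟩, ?_⟩
  have hq' : (0 : ℝ) < q := by exact_mod_cast hq
  have hp' : (0 : ℝ) < p := by exact_mod_cast hp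
  have hlam : (0 : ℝ) < (p : ℝ) / q := by positivity
  have hVr : (((q : ℤ) + p) * p * (B.V * 2 ^ 60) + ((q : ℤ) + p) * q *
      (2 * (B.dc - C.dc) ^ 2 + (B.zc - C.zc) ^ 2) : ℤ) ≤ (p : ℤ) * q * (C.V * 2 ^ 60) := hV
  have hVr' : (((q : ℝ) + p) * p * ((B.V : ℝ) * 2 ^ 60) + ((q : ℝ) + p) * q *
      (2 * ((B.dc : ℝ) - C.dc) ^ 2 + ((B.zc : ℝ) - C.zc) ^ 2)) ≤ (p : ℝ) * q * ((C.V : ℝ) * 2 ^ 60) := by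
    exact_mod_cast hVr
  refine ellipse_mono hlam gV ?_
  have key : (1 + (p : ℝ) / q) * ((p : ℝ) / q) * ((B.V : ℝ) / 2 ^ 60) +
      (1 + (p : ℝ) / q) * (2 * ((B.dc : ℝ) / 2 ^ 60 - (C.dc : ℝ) / 2 ^ 60) ^ 2 +
        ((B.zc : ℝ) / 2 ^ 60 - (C.zc : ℝ) / 2 ^ 60) ^ 2) =
      (((q : ℝ) + p) * p * ((B.V : ℝ) * 2 ^ 60) + ((q : ℝ) + p) * q *
        (2 * ((B.dc : ℝ) - C.dc) ^ 2 + ((B.zc : ℝ) - C.zc) ^ 2)) / ((q : ℝ) ^ 2 * 2 ^ 120) := by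
    field_simp
    try ring
  have key2 : (p : ℝ) / q * ((C.V : ℝ) / 2 ^ 60) =
      ((p : ℝ) * q * ((C.V : ℝ) * 2 ^ 60)) / ((q : ℝ) ^ 2 * 2 ^ 120) := by
    field_simp
    try ring
  rw [key, key2]
  exact div_le_div_of_nonneg_right hVr' (by positivity)

end TubeStage

end Summit.NavierStokesRegularity.FluidComputer
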